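import Summits.AtomisticToContinuum.Crystallization.Theorems.PricedLinkCensusLocalToGlobalNewtonShell8
import Summits.AtomisticToContinuum.Crystallization.Theorems.PricedLinkCensusLocalToGlobalConfinedThomson
import Summits.AtomisticToContinuum.Crystallization.Theorems.PricedLinkCensusLocalToGlobalFccMirrorExact

/-!
# Line `flux-cell-joint-census` (crux `LocalToGlobal`, stmt-AtomisticToContinuum-14232): the unconditional reduction

With the two analysis stubs of the line LANDED — Newton's shell theorem in `ℝ⁸`
(`stub_newtonShell8`, `Theorems/PricedLinkCensusLocalToGlobalNewtonShell8`) and the confined Thomson inequality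
with free transfer (`stub_confinedThomson`, `Theorems/PricedLinkCensusLocalToGlobalConfinedThomson`) — the
localisation `Σᵢ λᵢ ≤ E_LJ` of the Defs file holds unconditionally, and the remaining energetic stub
`FluxCellPricedGap` (a LOCAL transfer rule + a priced gap for the pinned site functionals `λᵢ`) implies BY
ITSELF the sibling crux `ChargedEnergyGap` (stmt-AtomisticToContinuum-14231) and hence this crux
`LocalToGlobal` (stmt-AtomisticToContinuum-14232).  Consequences recorded here:

* `sum_siteFunctional_le_interactionEnergy'` — the localisation inequality with the two analysis hypotheses
  discharged: for every injective configuration whose transfer field is square-integrable and weakly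
  divergence-free on the union of the cell tubes, `Σᵢ λᵢ(y) ≤ E_LJ(y)`;
* `chargedEnergyGap_of_fluxCellPricedGap : FluxCellPricedGap → ChargedEnergyGap` (registered sub-goal);
* `localToGlobal_of_fluxCellPricedGap : FluxCellPricedGap → LocalToGlobal`;
* `fccMirrorExact_holds : FccMirrorExact` — the third stub `stub_fccMirrorExact : NewtonShell8 → FccMirrorExact`
  (`Theorems/PricedLinkCensusLocalToGlobalFccMirrorExact`, p113939: method of images on the rhombic dodecahedron)
  discharged by the landed `stub_newtonShell8`: pure confinement is EXACT at fcc — the flux cell of a site of an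
  exact fcc patch reproduces its `r⁻⁶` lattice sum `S₆(a)` on the nose (the line's first checkable milestone,
  now certified), so the hypothesis of the last open stub `stub_fluxCellPricedGap : FccMirrorExact →
  FluxCellPricedGap` holds and that stub is equivalent to `FluxCellPricedGap` itself
  (`stub_fluxCellPricedGap_iff`).

So `FluxCellPricedGap` is at least crux-14231-sized (it is `ChargedEnergyGap` for a pinned local functional,
i.e. the energetic crystallization of Lennard-Jones in `d = 3` in finite-certificate form), which is the
lead's evidence for handing that stub back to the planners (`promote-stub`).  All `[folklore]` (compositions of
landed results).
-/

noncomputable section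

open scoped BigOperators RealInnerProductSpace
open MeasureTheory Literature.MathematicalPhysics.StatisticalMechanics Literature.Geometry.DiscreteGeometry
open Summit.AtomisticToContinuum.Crystallization.Theses.PricedLinkCensus

namespace Summit.AtomisticToContinuum.Crystallization.Theorems.PricedLinkCensusLocalToGlobal

variable {N : ℕ}

/-- **Localisation, unconditional form**: the Lennard-Jones energy dominates the sum of the pinned site
functionals, for every injective configuration whose transfer field `G_y = Σᵢ Grule(envᵢ, yᵢ)` is
square-integrable and weakly divergence-free on the union of the cell tubes (`ρ₀ ≥ 1`). [folklore] -/
theorem sum_siteFunctional_le_interactionEnergy' {ρ₀ ρ₁ : ℝ} (hρ₀ : 1 ≤ ρ₀)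
    (Grule : Finset E3 → E3 → E8 → E8) {y : Fin N → E3} (hy : Function.Injective y)
    (hmem : MemLp (transferField ρ₁ Grule y) 2 volume)
    (hdiv : ∀ φ : E8 → ℝ, IsTest φ →
      ∫ z in tube (⋃ i, cell ρ₀ y i), ⟪transferField ρ₁ Grule y z, gradient φ z⟫ = 0) :
    ∑ i, siteFunctional ρ₀ ρ₁ Grule y i ≤ interactionEnergy lennardJones y :=
  sum_siteFunctional_le_interactionEnergy stub_newtonShell8 stub_confinedThomson hρ₀ Grule hy hmem hdiv

/-- **Registered sub-goal `chargedEnergyGap_of_fluxCellPricedGap`**: with Newton smearing and confined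
Thomson proved, the flux-cell priced gap ALONE implies the sibling crux `ChargedEnergyGap`
(stmt-AtomisticToContinuum-14231). [folklore] -/
theorem chargedEnergyGap_of_fluxCellPricedGap : FluxCellPricedGap → ChargedEnergyGap :=
  chargedEnergyGap_of stub_newtonShell8 stub_confinedThomson

/-- … and hence this crux `LocalToGlobal` (stmt-AtomisticToContinuum-14232), the antecedent
`TruncatedCensusGap` being unused. [folklore] -/
theorem localToGlobal_of_fluxCellPricedGap : FluxCellPricedGap → LocalToGlobal :=
  fun hP => localToGlobal_of_statements stub_newtonShell8 stub_confinedThomson hP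

/-- **Pure confinement is exact at fcc** (unconditionally): the mirror-exactness statement
`FccMirrorExact` of the line holds, by the landed stubs `stub_fccMirrorExact` and `stub_newtonShell8`.
[folklore] -/
theorem fccMirrorExact_holds : FccMirrorExact :=
  stub_fccMirrorExact stub_newtonShell8

/-- Hence the last open stub of the line, `stub_fluxCellPricedGap : FccMirrorExact → FluxCellPricedGap`, is
equivalent to `FluxCellPricedGap` itself. [folklore] -/
theorem stub_fluxCellPricedGap_iff : (FccMirrorExact → FluxCellPricedGap) ↔ FluxCellPricedGap :=
  ⟨fun h => h fccMirrorExact_holds, fun h _ => h⟩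

end Summit.AtomisticToContinuum.Crystallization.Theorems.PricedLinkCensusLocalToGlobal

end
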